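import Summits.BirchSwinnertonDyer.BirchSwinnertonDyer.Theorems.AlignedTransportAtTwoMainConjectureOfRankZeroBSDAtTwoSharedCubicDivisionField
import Summits.BirchSwinnertonDyer.BirchSwinnertonDyer.Theorems.AlignedTransportAtTwoMainConjectureOfRankZeroBSDAtTwoPointFieldCarrierCMIff
import HarnessLib

/-!
# Route `AlignedTransportAtTwo`, crux C2 `MainConjectureOfRankZeroBSDAtTwo` (stmt-BirchSwinnertonDyer-22298):
# THE CM POINT FIELD INPUT AGREES ON A SHARED-CUBIC-FIELD PAIR — `μ₂(ℚ(β(W₁), i)^cyc) = 0 ⟺ μ₂(ℚ(β(W₂), i)^cyc) = 0` (C1's binders;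
# the `Δ > 0` atom CM6M⁺ of att-p3 g34's price list), so ALL FOUR atoms of the C2 input ledger are functions of the cubic field

HONEST FRAMING. WIDTH-5 attached prover seat `bsd-line-att-p4` g31 on line `birth` of the lead `bsd-line-att-p2`; `--supports`
stmt-BirchSwinnertonDyer-22298, closes nothing; BSD is NOT proved; crux C2, its verdict «blocked-on `Rank1Residual.GreenbergMuConjectureIrreducible`»
and every registered stub untouched. THEOREMS ONLY. Sequel of `…SharedCubicDivisionField` (same seat): there the PFμ⁺ CARRIER `ℚ(W[2]) ⊔ ℚ⟮i⟯`
was shown to coincide on the pair; att-p3 g34 (`…PointFieldCarrierCMIff`) proved `PFμ⁺(W) ⟺ μ₂(ℚ(β_j, i)^cyc) = 0` curve by curve. Composing: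

* `forall_classicalMuVanishes_pointFieldCM_iff_of_shared_cubic_field` — `W₁, W₂` without rational `2`-torsion abscissa, `Δ(W_i) ∉ ℚ²`,
  `±2Δ(W_i) ∉ ℚ²`, sharing a cubic field `F ∋ e₁, e₂`; `i² = −1`; any roots `j, j'`: **`μ₂ = 0` for every cyclotomic `ℤ₂`-tower of
  `ℚ⟮x(T_j(W₁))⟯ ⊔ ℚ⟮i⟯` iff of `ℚ⟮x(T_j'(W₂))⟯ ⊔ ℚ⟮i⟯`** (the two CM/complex sextics are conjugate but not equal as subfields of `ℚ̄`; the
  transport goes through the common degree-`12` carrier); `…_of_isOrdinaryAt` on the cruxes' binders.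

READING (C2 input ledger): H3M⁻ (`…SharedCubicDivisionField`), the resolvent (`…SharedCubicResolventField`), PFμ⁺ (ibid.) and now CM6M⁺ agree on every
shared-cubic-field pair: the whole price list of road (b″) is indexed by the cubic field. BSD is not proved by any of this.

References: [Iwasawa1973MuInvariants] Thm. 2, Thm. 3, §3; tree: att-p3 g34 `…PointFieldCarrierCMIff`, att-p4 g31 `…SharedCubicDivisionField`.
-/

-- the Theorems namespace of this sub repeats the summit name by design (D-0017 nested layout)
set_option linter.dupNamespace false
set_option autoImplicit false

noncomputable section

open scoped Classical NumberField

namespace Summit.BirchSwinnertonDyer.BirchSwinnertonDyer.Theorems.AlignedTransportAtTwoSharedCubicPointFieldCM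

open NumberField Polynomial WeierstrassCurve IntermediateField Field
  Literature.NumberTheory.EllipticCurves Literature.NumberTheory.EllipticCurves.Greenberg1999
  Literature.NumberTheory.EllipticCurves.DokchitserDokchitser2012
  Literature.NumberTheory.EllipticCurves.ZpExtension Literature.NumberTheory.GaloisRepresentations
  Literature.NumberTheory.IwasawaTheory Literature.NumberTheory.NumberFields
  Summit.BirchSwinnertonDyer.Rank1Residual.F1Sign2
  Summit.BirchSwinnertonDyer.BirchSwinnertonDyer.Theorems.AlignedTransportAtTwoSexticNormRelationDescentSignFree
  Summit.BirchSwinnertonDyer.BirchSwinnertonDyer.Theorems.AlignedTransportAtTwoPointFieldCarrierCMIff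
  Summit.BirchSwinnertonDyer.BirchSwinnertonDyer.Theorems.AlignedTransportAtTwoSharedCubicDivisionField

variable (W₁ W₂ : WeierstrassCurve ℚ) [W₁.IsElliptic] [W₂.IsElliptic]
  (ht₁ : ∀ x : ℚ, ¬ HasRationalTwoTorsionX W₁ x) (ht₂ : ∀ x : ℚ, ¬ HasRationalTwoTorsionX W₂ x)
  {F : Type} [Field F] [NumberField F] (hF : Module.finrank ℚ F = 3) {e₁ e₂ : F}
  (he₁ : aeval e₁ (twoDivisionUCubic W₁) = 0) (he₂ : aeval e₂ (twoDivisionUCubic W₂) = 0)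

include ht₁ ht₂ hF he₁ he₂ in
/-- ★ **CM6M⁺ agrees on the pair**: for `W₁, W₂` without rational `2`-torsion abscissa, `Δ(W_i) ∉ ℚ²`, `2Δ(W_i) ∉ ℚ²`, `−2Δ(W_i) ∉ ℚ²`, sharing a
cubic field (`F ∋ e₁, e₂`, `[F:ℚ] = 3`), `i² = −1`, any `j, j'`: `μ₂ = 0` for every cyclotomic `ℤ₂`-tower of `ℚ⟮x(T_j(W₁))⟯ ⊔ ℚ⟮i⟯` iff of
`ℚ⟮x(T_j'(W₂))⟯ ⊔ ℚ⟮i⟯` — both are equivalent (att-p3 g34) to the PFμ⁺ conclusion on the common carrier `ℚ(W₁[2]) ⊔ ℚ⟮i⟯ = ℚ(W₂[2]) ⊔ ℚ⟮i⟯`.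
[cite: Iwasawa1973MuInvariants, Thm. 2 and Thm. 3, §3] -/
theorem forall_classicalMuVanishes_pointFieldCM_iff_of_shared_cubic_field (hsq₁ : ¬ IsSquare W₁.Δ) (h2Δ₁ : ¬ IsSquare (2 * W₁.Δ))
    (hm2Δ₁ : ¬ IsSquare (-2 * W₁.Δ)) (hsq₂ : ¬ IsSquare W₂.Δ) (h2Δ₂ : ¬ IsSquare (2 * W₂.Δ)) (hm2Δ₂ : ¬ IsSquare (-2 * W₂.Δ))
    {i : AlgebraicClosure ℚ} (hi : i ^ 2 = -1) (j j' : Fin 3) :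
    (∀ κ₁ : ZpExtension ↥(ℚ⟮xT W₁ two_ne_zero j⟯ ⊔ IntermediateField.adjoin ℚ ({i} : Set (AlgebraicClosure ℚ))) 2,
        κ₁.IsCyclotomic → ClassicalMuVanishes κ₁) ↔
      ∀ κ₂ : ZpExtension ↥(ℚ⟮xT W₂ two_ne_zero j'⟯ ⊔ IntermediateField.adjoin ℚ ({i} : Set (AlgebraicClosure ℚ))) 2,
        κ₂.IsCyclotomic → ClassicalMuVanishes κ₂ := by
  rw [← classicalMuVanishes_sup_adjoin_I_iff_pointFieldCM W₁ ht₁ hsq₁ h2Δ₁ hm2Δ₁ hi j,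
    ← classicalMuVanishes_sup_adjoin_I_iff_pointFieldCM W₂ ht₂ hsq₂ h2Δ₂ hm2Δ₂ hi j',
    forall_classicalMuVanishes_sup_iff_of_shared_cubic_field W₁ W₂ ht₁ ht₂ hF he₁ he₂]

include ht₁ ht₂ hF he₁ he₂ in
/-- **CM6M⁺ agrees on the pair, on the cruxes' binders** (`W_i` globally minimal, good ordinary at `2`: `±2Δ ∉ ℚ²` automatic; `Δ(W_i) ∉ ℚ²`).
[cite: Iwasawa1973MuInvariants, Thm. 2 and Thm. 3, §3] -/
theorem forall_classicalMuVanishes_pointFieldCM_iff_of_shared_cubic_field_of_isOrdinaryAt [W₁.IsGloballyMinimal] [W₂.IsGloballyMinimal]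
    (hord₁ : IsOrdinaryAt W₁ 2) (hord₂ : IsOrdinaryAt W₂ 2) (hsq₁ : ¬ IsSquare W₁.Δ) (hsq₂ : ¬ IsSquare W₂.Δ)
    {i : AlgebraicClosure ℚ} (hi : i ^ 2 = -1) (j j' : Fin 3) :
    (∀ κ₁ : ZpExtension ↥(ℚ⟮xT W₁ two_ne_zero j⟯ ⊔ IntermediateField.adjoin ℚ ({i} : Set (AlgebraicClosure ℚ))) 2,
        κ₁.IsCyclotomic → ClassicalMuVanishes κ₁) ↔
      ∀ κ₂ : ZpExtension ↥(ℚ⟮xT W₂ two_ne_zero j'⟯ ⊔ IntermediateField.adjoin ℚ ({i} : Set (AlgebraicClosure ℚ))) 2,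
        κ₂.IsCyclotomic → ClassicalMuVanishes κ₂ := by
  rw [← classicalMuVanishes_sup_adjoin_I_iff_pointFieldCM_of_isOrdinaryAt W₁ hord₁ ht₁ hsq₁ hi j,
    ← classicalMuVanishes_sup_adjoin_I_iff_pointFieldCM_of_isOrdinaryAt W₂ hord₂ ht₂ hsq₂ hi j',
    forall_classicalMuVanishes_sup_iff_of_shared_cubic_field W₁ W₂ ht₁ ht₂ hF he₁ he₂]

end Summit.BirchSwinnertonDyer.BirchSwinnertonDyer.Theorems.AlignedTransportAtTwoSharedCubicPointFieldCM

end
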